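import Literature.Probability.Percolation.VerticalTransportStep
import HarnessLib

/-!
# Transport of vertical crossings (GM14 Proposition 6.8) — IV: the inequality on the strip

Grimmett–Manolescu, *Bond percolation on isoradial graphs* (PTRF 159 (2014) 273–327 =
arXiv:1204.0505), §6.3, Proposition 6.8: "There exists `c_N = c_N(δ) > 0` satisfying `c_N → 1` as
`N → ∞` such that `P_{α,β}(C_v[B(4N, δN)]) ≥ c_N P_{α,ξ}(C_v[B(N, N)])`", proved in the form (6.31)
"`P(h^N ≥ δN) ≥ c_N P(h^0 ≥ N)`": "The box `B(N, N)` is contained in `D^0`, and lies entirely in the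
regular block of `G^0`. The box `B(4N, δN)` contains the part of `D^N` between heights `0` and `N`,
and lies in the irregular section of `G^N`."

This file assembles (6.31) for the process of `VerticalTransportProcess` from the tail bound of
`ChainTailBound` (hypotheses: `measure_drop_eq_zero`, `measure_keep_eq_zero`,
`theta_mul_measureReal_le`) and the binomial lower bound of `ChainTailBoundBinomial` (the levels of
the `N²` exchanges form `N` blocks of `N` consecutive levels, `ℓN_block`):

* **`VData.vertical_transport_strip`** — for valid data (`BAC(ε)` on a strip of half-width
  `M ≥ 4N + 4`) and `u ≤ θ(ε) N / 2`,
  `(θ(ε)/2) · P_0(h_0 = N) ≤ P_{N²}(h_{N²} ≥ u)`, where `P_0` is the canonical measure of the strip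
  with the regular angle `ξ` on all levels `< N` (GM14's `P_{α,β̃}`), `P_{N²}` the one with
  `β_0, …, β_{N-1}` on the levels `0, …, N-1`, `h_0` the record height in the trapezium
  `Dom N N ⊇ B(N, N)` and `h_{N²}` the one in `Dom 3N 0 = {|m| ≤ 3N + y}`. The constant
  `θ(ε)/2 = ¼ sin³(ε/3)` replaces the printed `c_N → 1` (a uniform positive constant is what the
  box-crossing estimates use);
* the two event inclusions turning records into crossings: `hRec_eq_of_crossing` (an open path of
  the box `{|m| ≤ N, 0 ≤ y ≤ N}` from height `0` to height `N` forces `h_0 = N`) and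
  `crossing_of_le_hRec` (if `h ≥ u` then, in a clean configuration, some open path inside
  `{|m| ≤ 3N + u + 2, 0 ≤ y ≤ u}` joins height `0` to height `u`: a vertical crossing of a
  `(6N + 2u + 4) × u` box).

## References

* G. R. Grimmett, I. Manolescu, PTRF 159 (2014) 273–327, arXiv:1204.0505, §6.3 (Proposition 6.8,
  (6.29)–(6.31), Lemma 6.9).
-/

noncomputable section

namespace Literature.Probability.Percolation

open LatticeModels StarTriangle Real MeasureTheory

namespace TrackExchange

namespace VData

variable (V : VData)

/-! ### The levels form blocks -/

/-- **The levels of the exchanges form `N` blocks of `N` consecutive levels**: exchange `kN + s` has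
level `(N - k) + s`. [cite: GrimmettManolescu2014Isoradial, §6.3 (6.29)] -/
theorem ℓN_block {k s : ℕ} (hk : k < V.N) (hs : s < V.N) : V.ℓN (k * V.N + s) = (V.N - k) + s := by
  have hN : 0 < V.N := by omega
  have h1 : (k * V.N + s) / V.N = k := by
    rw [Nat.add_comm, Nat.add_mul_div_right _ _ hN, Nat.div_eq_of_lt hs, Nat.zero_add]
  have h2 : (k * V.N + s) % V.N = s := by
    rw [Nat.add_comm, Nat.add_mul_mod_self_right, Nat.mod_eq_of_lt hs]
  unfold ℓN ℓT level
  rw [h1, h2]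
  omega

/-! ### The inequality on the strip -/

variable {V}

/-- **GM14 (6.31) / Proposition 6.8 on the strip**: `(θ(ε)/2) · P_0(h_0 = N) ≤ P_{N²}(h_{N²} ≥ u)` for
`u ≤ θ(ε) N / 2`, valid data and a strip of half-width `M ≥ 4N + 4`.
[cite: GrimmettManolescu2014Isoradial, §6.3 Prop. 6.8, (6.31)] -/
theorem vertical_transport_strip {ε : ℝ} (hV : V.Valid ε) (hM : 4 * V.N + 4 ≤ V.M) {u : ℕ}
    (hu : (u : ℝ) ≤ θ ε * V.N / 2) :
    θ ε / 2 * (V.μt 0).real {ω | hRec (V.DomT 0) V.N ω = V.N} ≤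
      (V.μt (V.N * V.N)).real {ω | u ≤ hRec (V.DomT (V.N * V.N)) V.N ω} := by
  obtain ⟨hθ0, hθ1⟩ := θ_pos_le hV.ε_pos hV.ε_lt
  -- the tail bound along the process
  have htail := RandomMapChain.tailF_mul_le_measureReal (P := V.P) hθ0.le hθ1 (V.N * V.N) (fun t => V.G t)
    (fun t => V.measurable_G t) (fun t => V.ℓN t) (fun t ht => measure_drop_eq_zero hV hM ht)
    (fun t ht => measure_keep_eq_zero hV hM ht) (fun t ht => theta_mul_measureReal_le hV hM ht) u V.N
  -- the comparison chain over the blocks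
  have hcmp : θ ε / 2 ≤ RandomMapChain.tailF (θ ε) u ((List.range (V.N * V.N)).map fun t => V.ℓN t) V.N :=
    RandomMapChain.half_theta_le_tailF hθ0 hθ1 (fun t => V.ℓN t) (fun k => V.N - k)
      (fun k hk s hs => V.ℓN_block hk hs) hu
  -- the initial and final events as events of the process
  have h0 : V.P.real {x | V.G 0 x = V.N} = (V.μt 0).real {ω | hRec (V.DomT 0) V.N ω = V.N} := by
    have hset : {x : V.Ω | V.G 0 x = V.N} = (fun x => V.cfgAt x 0) ⁻¹' {ω | hRec (V.DomT 0) V.N ω = V.N} := by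
      ext x; simp [G]
    rw [hset, measureReal_def, measureReal_def, ← Measure.map_apply (V.measurable_cfgAt 0) (measurableSet_hRec_eq _ _ _),
      V.map_cfgAt_zero]
  have h1 : V.P.real {x | u ≤ V.G (V.N * V.N) x} = (V.μt (V.N * V.N)).real {ω | u ≤ hRec (V.DomT (V.N * V.N)) V.N ω} := by
    have hset : {x : V.Ω | u ≤ V.G (V.N * V.N) x} =
        (fun x => V.cfgAt x (V.N * V.N)) ⁻¹' {ω | u ≤ hRec (V.DomT (V.N * V.N)) V.N ω} := by
      ext x; simp [G]
    rw [hset, measureReal_def, measureReal_def,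
      ← Measure.map_apply (V.measurable_cfgAt _) (measurableSet_le measurable_const (measurable_hRec _ _)),
      V.map_cfgAt_final hV]
  rw [← h0, ← h1]
  calc θ ε / 2 * V.P.real {x | V.G 0 x = V.N}
      ≤ RandomMapChain.tailF (θ ε) u ((List.range (V.N * V.N)).map fun t => V.ℓN t) V.N * V.P.real {x | V.G 0 x = V.N} :=
        mul_le_mul_of_nonneg_right hcmp measureReal_nonneg
    _ ≤ V.P.real {x | u ≤ V.G (V.N * V.N) x} := htail

/-! ### Records and crossings -/

/-- **An open path of the box `B(N, N) = {|m| ≤ N, 0 ≤ y ≤ N}` from height `0` to height `N` forces the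
initial record to be `N`** ("the box `B(N, N)` is contained in `D^0`"). [cite: GrimmettManolescu2014Isoradial, §6.3] -/
theorem hRec_eq_of_crossing {ω : Set (Sym2 SV)} {W : List SV} (hW : IsWalk ω W)
    (hbox : ∀ z ∈ W, ∃ a : ℤ × ℤ, z = some a ∧ |a.1| ≤ V.N ∧ 0 ≤ a.2 ∧ a.2 ≤ V.N)
    (hhead : ∃ a : ℤ × ℤ, W.head? = some (some a) ∧ a.2 = 0) (hlast : ∃ b : ℤ × ℤ, W.getLast? = some (some b) ∧ b.2 = V.N) :
    hRec (V.DomT 0) V.N ω = V.N := by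
  refine le_antisymm (hRec_le (reaches_zero (V.zero_mem_DomT 0))) (le_hRec le_rfl ⟨W, hW, fun z hz => ?_, hhead, hlast⟩)
  obtain ⟨a, rfl, h1, h2, h3⟩ := hbox z hz
  refine ⟨a, rfl, h2, ?_⟩
  unfold cT
  simp only [Nat.zero_div, Nat.cast_zero, mul_zero, add_zero]
  split_ifs <;> omega

/-- **Discrete intermediate values**: a walk whose heights rise by at most one per step, from
height `≤ u` to height `≥ u`, visits height `u`. [folklore] -/
theorem exists_lht_eq {u : ℤ} : ∀ {W : List SV}, (∀ a b, [a, b] <:+: W → lht b ≤ lht a + 1) →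
    (∀ z, W.head? = some z → lht z ≤ u) → (∃ z, W.getLast? = some z ∧ u ≤ lht z) → ∃ z ∈ W, lht z = u
  | [], _, _, ⟨z, hz, _⟩ => by simp at hz
  | [a], _, hh, ⟨z, hz, hzu⟩ => by
    simp only [List.getLast?_singleton, Option.some.injEq] at hz
    subst hz
    exact ⟨a, List.mem_singleton_self _, le_antisymm (hh a rfl) hzu⟩
  | a :: b :: l, hstep, hh, ⟨z, hz, hzu⟩ => by
    by_cases ha : lht a = u
    · exact ⟨a, List.mem_cons_self, ha⟩
    · have ha' : lht a < u := lt_of_le_of_ne (hh a rfl) ha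
      have hb : lht b ≤ u := by
        have := hstep a b (pair_infix_cons_cons a b l); omega
      obtain ⟨w, hw, hwu⟩ := exists_lht_eq (W := b :: l) (fun c d hcd => hstep c d (List.infix_cons hcd))
        (fun w hw => by simp only [List.head?_cons, Option.some.injEq] at hw; rw [← hw]; exact hb)
        ⟨z, by rwa [List.getLast?_cons_cons] at hz, hzu⟩
      exact ⟨w, List.mem_cons_of_mem _ hw, hwu⟩

/-- `cutAt` is a prefix. [folklore] -/
theorem cutAt_prefix (y : ℤ) : ∀ W : List SV, cutAt y W <+: W
  | [] => by simp [cutAt]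
  | x :: rest => by
    simp only [cutAt]
    split_ifs
    · exact ⟨rest, by simp⟩
    · obtain ⟨t, ht⟩ := cutAt_prefix y rest
      exact ⟨t, by rw [List.cons_append, ht]⟩

/-- **A record `≥ u` yields a vertical crossing of the box `{|m| ≤ 3N + u + 2, 0 ≤ y ≤ u}`** (clean
configuration; "the box `B(4N, δN)` contains the part of `D^N` between heights `0` and `N`").
[cite: GrimmettManolescu2014Isoradial, §6.3] -/
theorem crossing_of_le_hRec {ω : Set (Sym2 SV)} (hc : Clean (V.weightsT (V.N * V.N)) ω) {u : ℕ}
    (hu : u ≤ hRec (V.DomT (V.N * V.N)) V.N ω) :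
    ∃ W : List SV, IsWalk ω W ∧ (∀ z ∈ W, ∃ a : ℤ × ℤ, z = some a ∧ |a.1| ≤ 3 * V.N + u + 2 ∧ 0 ≤ a.2 ∧ a.2 ≤ u) ∧
      (∃ a : ℤ × ℤ, W.head? = some (some a) ∧ a.2 = 0) ∧ ∃ b : ℤ × ℤ, W.getLast? = some (some b) ∧ b.2 = u := by
  have h0 : Reaches (V.DomT (V.N * V.N)) ω 0 := reaches_zero (V.zero_mem_DomT _)
  -- a top witness of the record
  obtain ⟨W₁, hW₁⟩ := exists_topWit hc (by positivity) (reaches_hRec (S := V.DomT (V.N * V.N)) (N := V.N) h0)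
  obtain ⟨a₀, ha₀, ha₀0⟩ := hW₁.head
  obtain ⟨b₀, hb₀, hb₀y⟩ := hW₁.last
  -- heights move by one along `W₁`
  have hstep : ∀ a b, [a, b] <:+: W₁ → lht b ≤ lht a + 1 := by
    intro a b hab
    have he := hW₁.walk.mem_of_infix hab
    obtain ⟨a', rfl, -⟩ := hW₁.dom a (hab.subset (by simp))
    obtain ⟨b', rfl, -⟩ := hW₁.dom b (hab.subset (by simp))
    have := (lht_step_of_clean hc he).2
    simp only [lht]; omega
  -- `W₁` visits height `u`; cut there
  have hmem : ∃ z ∈ W₁, lht z = u :=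
    exists_lht_eq hstep (fun z hz => by rw [ha₀] at hz; cases hz; simp only [lht]; omega)
      ⟨some b₀, hb₀, by simp only [lht]; exact_mod_cast hb₀y ▸ (Int.ofNat_le.2 hu)⟩
  set W := cutAt u W₁ with hWdef
  have hWne : W₁ ≠ [] := by intro h; rw [h] at ha₀; simp at ha₀
  obtain ⟨z, hz, hzu⟩ := getLast?_cutAt (u : ℤ) hmem
  -- the prefix is strictly below `u` before its last vertex
  have hpre : (cutAt u W₁).dropLast <+: cutAt u W₁ := List.dropLast_prefix _
  have hbelow : ∀ w ∈ (cutAt (u : ℤ) W₁).dropLast, lht w < u := by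
    refine lht_lt_of_forall_ne (fun c d hcd => hstep c d ?_) (fun w hw => ?_)
      (fun w hw => lht_ne_of_mem_dropLast_cutAt (u : ℤ) hw)
    · -- consecutive in the prefix of the cut, hence in `W₁`
      obtain ⟨s₁, t₁, hst⟩ := hcd
      obtain ⟨t₂, ht₂⟩ := hpre
      obtain ⟨t₃, ht₃⟩ := cutAt_prefix (u : ℤ) W₁
      refine ⟨s₁, t₁ ++ t₂ ++ t₃, ?_⟩
      rw [← ht₃, ← ht₂, ← hst]; simp [List.append_assoc]
    · have h1 : (cutAt (u : ℤ) W₁).head? = some (some a₀) := by rw [head?_cutAt, ha₀]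
      cases hl : (cutAt (u : ℤ) W₁).dropLast with
      | nil => rw [hl] at hw; simp at hw
      | cons w' l =>
        rw [hl] at hw hpre
        simp only [List.head?_cons, Option.some.injEq] at hw
        subst hw
        obtain ⟨t₄, ht₄⟩ := hpre
        rw [← ht₄] at h1
        simp only [List.cons_append, List.head?_cons, Option.some.injEq] at h1
        subst h1
        simp only [lht]; omega
  refine ⟨W, isWalk_cutAt _ hW₁.walk, fun w hw => ?_, ⟨a₀, by rw [hWdef, head?_cutAt, ha₀], ha₀0⟩, ?_⟩
  · obtain ⟨a, rfl, haD⟩ := hW₁.dom w (mem_of_mem_cutAt _ hw)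
    refine ⟨a, rfl, ?_, haD.1, ?_⟩
    · have h1 := abs_le_of_mem_Dom (c := V.cT (V.N * V.N)) (ℓ := V.ℓT (V.N * V.N)) haD
      have h2 := cT_le (V := V) (le_refl (V.N * V.N))
      have h3 : a.2 ≤ u := by
        rcases mem_dropLast_or_getLast hw with h | h
        · have := hbelow _ h; simp only [lht] at this; omega
        · rw [hz] at h; cases h; simp only [lht] at hzu; omega
      omega
    · rcases mem_dropLast_or_getLast hw with h | h
      · have := hbelow _ h; simp only [lht] at this; omega
      · rw [hz] at h; cases h; simp only [lht] at hzu; omega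
  · obtain ⟨b, rfl, -⟩ := hW₁.dom z (mem_of_mem_cutAt _ (List.mem_of_getLast? hz))
    exact ⟨b, hz, by simpa [lht] using hzu⟩

end VData

end TrackExchange

end Literature.Probability.Percolation
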